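import Summits.QuantumFields.BalabanUV.Beta.EriceRemainderEnclosureHistoryAutonomyComparisonContinuumDirectGauge

/-!
# EriceRemainderEnclosureHistoryAutonomyComparisonContinuumTimeBudget — (E131) **THE TIME BUDGET: ALGEBRAIC CORE OF «(E58′) IN THE CONTINUUM FOR EVERY
# ADMISSIBLE `u_0`-EXCESS AT EVERY AMPLITUDE, WITH THE DIRECT GAUGE COST `≤ 5∕8`» — the constant of the LINEARISED problem (g101 (LP)).**
Continuum model of the comparison column (`HOME/b2b-balaban-beta-d4-p2/g100/README.md` §2; direct nonlinear gauge (D′) of g102 §4 ∕ (E129); this generation's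
`g103/README.md` §2bis).  (E129)∕(E130) converted the time-integral `Ξ_r = ∫_window X dτ` (which bounds the gap of the window tops, g102 §4 (b)) into a LEVEL integral
and paid for the conversion with the perturbed speed at the window cap — the source of every amplitude dependence ((E129): `η ≤ 0.75Φ₀(A*)`; (E130): sharp step only,
via the speed credit).  KEEPING TIME: with the gauge `X(μ) ≤ (μ∕α)X(α)` inside the window, the whole window-shift piece of `αX′∕X` per block is
`(s∕2)·((y+1)∕y²)·I`, `I := (Φ₀(ℓ⁰)∕ℓ⁰²)·∫_{window below the support top} ℓ^η(τ) dτ = ∫_x^{x̂} u·ρ(u) du`, `ρ(u) = Φ₀(ℓ⁰)∕Φ_η(uℓ⁰)` the speed ratio along the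
perturbed window — and `ρ` obeys (i) `ρ ≤ 1` below the base top and `ρ ≤ √u` above it (`Φ_η ≥ Φ₀`, `Φ₀` antitone, `Φ₀√ℓ` isotone), so `ρ ≤ √y =: t` throughout, and (ii) THE
TIME BUDGET `∫ρ du = Φ₀(ℓ⁰)·(window time)∕ℓ⁰ ≤ Φ₀(ℓ⁰)k_r∕ℓ⁰ ≤ 1 − x` (the perturbed window lasts exactly as long as the base window).  The bathtub principle then gives
`I ≤ (1−x)·y − (1−x)²∕(2t)` (all the time spent as high as possible), and the per-unit-share cost is at most
`F̃(x,t) = x∕(2t³) + (1∕2)((t²+1)∕t⁴)(1−x)(t² − (1−x)∕(2t))`, whose supremum over `0 ≤ x ≤ 1 ≤ t` is EXACTLY `5∕8`, attained only at `t = 1`, `x = 1∕2` — the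
unperturbed corner, g101's affine cost `(1+x−x²)∕2`.  NOTHING about the source is used except that it is non-negative and non-increasing in the level (it enters
`X′` with the helpful sign), so the continuous induction of g102 §4 (e) yields **(E58′) — `X > 0`, `X∕α` non-increasing below the support top — for EVERY admissible
`u_0`-excess (sharp, staircase, ramp, soft tail, …) at EVERY amplitude, on every tower, any floor `b ≥ 0`, any affine Markov weight**: the continuum column for
`u_0`-excesses is closed.  THIS FILE is the finite, derivative-free part: (§1) **`window_shift_time_le`** (the window-shift piece through the time integral); (§2)
**`bathtub_poly_le`** (`2xt² + (t²+1)(1−x)(2t³ − (1−x)) ≤ (5∕2)t⁵`), **`block_timebudget_le`** (per-unit-share cost `≤ 5∕8` given the bathtub bound on `I`); (§3)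
**`cost_timebudget_le`**, **`gauge_timebudget_decreasing`** (budget sum over blocks; gauge step `αX′ − X ≤ −(3∕8)X`).  The bathtub rearrangement itself
(`∫uρ ≤ t∫_{y−(1−x)∕t}^{y} u du` for `0 ≤ ρ ≤ t`, `∫ρ ≤ 1−x`, `u ≤ y`) is three lines of calculus and stays on paper (README §2bis (vii)).  Numerics (README §3bis): on
sharp steps, staircases, ramps and power tails at `η∕Φ₀` up to 100 the time-budget cost is `≤ 0.56` on every computed pin and dominates the measured `αX′∕X` everywhere.

Cell `pub-balaban`, β-function sub-cell, BINDER row D4 «RemainderConst leaves for Bałaban's split» (`HOME/BINDER-OWNERS.md`; owner lineage `b2b-balaban-beta-an4`;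
this file by co-owner #2 lineage `b2b-balaban-beta-d4-p2`, generation 103), β-FLOW TEAM duty (1), FREEZE (0) honoured (def-free; imports (E129) only; restates nothing).

HONEST FRAMING (page 1, verbatim and binding).  *"Discharging BetaPertH makes Bałaban's UV stability UNCONDITIONAL — a real constructive-QFT result; it is
NOT the continuum limit and NOT the Clay problem."*  THIS FILE DISCHARGES NOTHING OF THE KIND.  Elementary real algebra about abstract reals standing for the
blocks of the cell's continuum model of an abstract flow with memory — hypotheses of a census, not facts; the form, signs, ages and moments of Bałaban's (1.22)
limit functional are NOT PRINTED ([I] p. 298; GAPS G-t4-U2-1∕-2) and NOT asserted.  Row D4 class UNCHANGED (critical-path width 0; instance 0∕1; D4 DISCHARGE NO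
DATE).  HONEST DEPENDENCY: continuum YM on T⁴ ⇐ BetaPertH ∧ nine spine estimates (0/9 proved); BetaPertH ⇐ (D1) ∧ (D4) ∧ CAP+tail; G-an2-4 gates asym, D1 and
NE2/3/4.  NOT CLAIMED: the LATTICE statement (E58′), excesses depending on older couplings `u_J` (steep onsets), anything printed — NOT B12 Thm 2, NOT BetaPertH,
NOT continuum, NOT Clay.

WHAT IS PROVED ([folklore]; 0 `def`, 0 sorry).  §1 **`window_shift_time_le`**.  §2 **`bathtub_poly_le`**, **`block_timebudget_le`**.  §3 **`cost_timebudget_le`**,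
**`gauge_timebudget_decreasing`**.  v1.1 (same unit and generation) APPENDS §4 — the DISCRETE bathtub for the lattice transcription (README §4 (3″) (e)):
**`discrete_bathtub_le`** (`k` levels packed below a top `Y` with spacing `d`: `Σ a_l ≤ kY − d·k(k−1)∕2`), **`bathtub_mass_mono`** (`m ↦ y m − m²∕(2t)` is monotone for
`m ≤ T ≤ t·y`, so the budget may be saturated) — and modifies NO existing declaration.  POSTSCRIPT to «NOT CLAIMED» above (README §2 remark (6)): sources read at OLDER
couplings (`u_J`-excesses, any isotone functional of the coupling history) ARE covered by the same algebra — their level-derivative has the helpful sign in the direct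
comparison; the line was written before that remark.
-/

noncomputable section
open Finset Real
open Summit.QuantumFields.BalabanUV.Beta.EriceRemainderEnclosureHistoryAutonomyComparisonContinuumDirectGauge

namespace Summit.QuantumFields.BalabanUV.Beta.EriceRemainderEnclosureHistoryAutonomyComparisonContinuumTimeBudget

/-! ## §1 The window-shift piece through the time integral -/

/-- **THE WINDOW-SHIFT PIECE, KEPT IN TIME.**  Block with base share `s = L∕(r0·Φ0a)` at the pin `α > 0` (`Φ0a = Φ₀(α) > 0`, `L ≥ 0`), base top `ℓ0 = r0²`, ratio
`y = ℓη∕ℓ0 ≥ 1`; deficit `D ≤ (Φ0t∕(ℓ0·r0))·(1 − 1∕y²)` ((E129) `weight_deficit_le`; `Φ0t ≥ 0` the base speed at the base top); tops gap `y − 1 ≤ Ξ∕ℓ0` (g102 §4 (b)); the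
GAUGE inside the window in TIME form `Ξ ≤ (X∕α)·J`, `J = ∫ ℓ^η(τ)dτ` over the part of the perturbed window below the support top.  Then with
`I := Φ0t·J∕ℓ0²` the block's contribution `α·(L∕2)·D∕Φ0a` to `αX′` is at most `X·(s∕2)·((y+1)∕y²)·I`. [folklore] -/
theorem window_shift_time_le {α ℓ0 r0 L s Φ0a Φ0t D y Ξ J X I : ℝ} (hα : 0 < α) (hr0 : 0 < r0) (hℓ0 : r0 ^ 2 = ℓ0) (hΦ0a : 0 < Φ0a) (hL : 0 ≤ L)
    (hs : s = L / (r0 * Φ0a)) (hy1 : 1 ≤ y) (hΦ0t : 0 ≤ Φ0t) (hD : D ≤ Φ0t / (ℓ0 * r0) * (1 - 1 / y ^ 2))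
    (hyΞ : y - 1 ≤ Ξ / ℓ0) (hΞ : Ξ ≤ X / α * J) (hI : I = Φ0t * J / ℓ0 ^ 2) :
    α * (L / 2) * D / Φ0a ≤ X * (s / 2) * ((y + 1) / y ^ 2 * I) := by
  have hℓ0p : 0 < ℓ0 := by rw [← hℓ0]; positivity
  have hy0 : 0 < y := by linarith
  have hy1' : y - 1 ≤ X / α * J / ℓ0 := by
    have := div_le_div_of_nonneg_right hΞ hℓ0p.le
    linarith [hyΞ]
  have hfac : 0 ≤ Φ0t / (ℓ0 * r0) * ((y + 1) / y ^ 2) := by positivity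
  have hD' : D ≤ Φ0t / (ℓ0 * r0) * ((y + 1) / y ^ 2) * (y - 1) := by
    have e : Φ0t / (ℓ0 * r0) * (1 - 1 / y ^ 2) = Φ0t / (ℓ0 * r0) * ((y + 1) / y ^ 2) * (y - 1) := by
      field_simp
      ring
    linarith [hD, e.le, e.ge]
  have hD'' : D ≤ Φ0t / (ℓ0 * r0) * ((y + 1) / y ^ 2) * (X / α * J / ℓ0) := hD'.trans (mul_le_mul_of_nonneg_left hy1' hfac)
  have hcoef : 0 ≤ α * (L / 2) / Φ0a := by positivity
  have step1 : α * (L / 2) * D / Φ0a ≤ α * (L / 2) / Φ0a * (Φ0t / (ℓ0 * r0) * ((y + 1) / y ^ 2) * (X / α * J / ℓ0)) := by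
    have e : α * (L / 2) * D / Φ0a = α * (L / 2) / Φ0a * D := by ring
    rw [e]; exact mul_le_mul_of_nonneg_left hD'' hcoef
  have e2 : α * (L / 2) / Φ0a * (Φ0t / (ℓ0 * r0) * ((y + 1) / y ^ 2) * (X / α * J / ℓ0)) = X * (s / 2) * ((y + 1) / y ^ 2 * I) := by
    rw [hs, hI]; field_simp
  linarith [step1, e2.le]

/-! ## §2 The bathtub polynomial and the per-block bound `5∕8` -/

/-- `2xt² + (t²+1)(1−x)(2t³ − (1−x)) ≤ (5∕2)t⁵` for `0 ≤ x`, `1 ≤ t` (`x ≤ 1` is not needed) — i.e. `F̃(x,t) = x∕(2t³) + (1∕2)((t²+1)∕t⁴)(1−x)(t² − (1−x)∕(2t)) ≤ 5∕8`, with equality exactly at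
`t = 1`, `x = 1∕2` (there the margin is `2(x − 1∕2)²`).  Proof: with `v := t − 1 ≥ 0` the margin is `2(x−1∕2)²` plus a polynomial in `(v, x, 1−x)` with non-negative
coefficients. [folklore] -/
theorem bathtub_poly_le {x t : ℝ} (hx0 : 0 ≤ x) (ht1 : 1 ≤ t) :
    2 * x * t ^ 2 + (t ^ 2 + 1) * (1 - x) * (2 * t ^ 3 - (1 - x)) ≤ 5 / 2 * t ^ 5 := by
  -- with v = t - 1 ≥ 0 the margin is  2(x−½)² + v(−3∕2 + 8x + 2x²) + v²(22x + x²) + v³(3 + 22x) + v⁴(5∕2 + 10x) + v⁵(1∕2 + 2x)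
  have hv : 0 ≤ t - 1 := by linarith
  have key : 5 / 2 * t ^ 5 - (2 * x * t ^ 2 + (t ^ 2 + 1) * (1 - x) * (2 * t ^ 3 - (1 - x)))
      = 2 * (x - 1 / 2) ^ 2 + (t - 1) * (-3 / 2 + 8 * x + 2 * x ^ 2) + (t - 1) ^ 2 * (22 * x + x ^ 2) + (t - 1) ^ 3 * (3 + 22 * x)
        + (t - 1) ^ 4 * (5 / 2 + 10 * x) + (t - 1) ^ 5 * (1 / 2 + 2 * x) := by ring
  have hrest : 0 ≤ (t - 1) * (2 * x ^ 2) + (t - 1) ^ 2 * (22 * x + x ^ 2) + (t - 1) ^ 3 * (22 * x)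
        + (t - 1) ^ 4 * (5 / 2 + 10 * x) + (t - 1) ^ 5 * (1 / 2 + 2 * x) := by positivity
  -- the delicate part: G := 2(x−½)² + v(−3∕2 + 8x) + 3v³ ≥ 0
  have hG : 0 ≤ 2 * (x - 1 / 2) ^ 2 + (t - 1) * (-3 / 2 + 8 * x) + 3 * (t - 1) ^ 3 := by
    rcases le_or_gt t (5 / 4) with h | h
    · -- v ≤ 1/4:  G = 2(x − ½ + 2v)² + v(3v² − 8v + 5∕2) and 3v² − 8v + 5∕2 ≥ 5∕2 − 8v ≥ 1∕2
      have h1 : 0 ≤ 3 * (t - 1) ^ 2 - 8 * (t - 1) + 5 / 2 := by nlinarith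
      have e : 2 * (x - 1 / 2) ^ 2 + (t - 1) * (-3 / 2 + 8 * x) + 3 * (t - 1) ^ 3
          = 2 * (x - 1 / 2 + 2 * (t - 1)) ^ 2 + (t - 1) * (3 * (t - 1) ^ 2 - 8 * (t - 1) + 5 / 2) := by ring
      rw [e]; positivity
    · -- v ≥ 1/4:  G = (1∕2 − (3∕2)v + 3v³) + 2x(x − 1 + 4v), with 1∕2 − (3∕2)v + 3v³ ≥ 0 (from v(v − 2∕5)² ≥ 0) and x − 1 + 4v ≥ x ≥ 0
      have hv4 : 0 ≤ 4 * (t - 1) - 1 := by linarith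
      have hU : 0 ≤ 1 / 2 - 3 / 2 * (t - 1) + 3 * (t - 1) ^ 3 := by
        nlinarith [mul_nonneg hv (sq_nonneg (t - 1 - 2 / 5)), sq_nonneg (t - 1 - 33 / 80)]
      have e : 2 * (x - 1 / 2) ^ 2 + (t - 1) * (-3 / 2 + 8 * x) + 3 * (t - 1) ^ 3
          = (1 / 2 - 3 / 2 * (t - 1) + 3 * (t - 1) ^ 3) + 2 * x * x + 2 * x * (4 * (t - 1) - 1) := by ring
      rw [e]
      have : 0 ≤ 2 * x * x := by positivity
      have : 0 ≤ 2 * x * (4 * (t - 1) - 1) := by positivity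
      linarith
  have hsplit : 2 * (x - 1 / 2) ^ 2 + (t - 1) * (-3 / 2 + 8 * x + 2 * x ^ 2) + (t - 1) ^ 2 * (22 * x + x ^ 2) + (t - 1) ^ 3 * (3 + 22 * x)
        + (t - 1) ^ 4 * (5 / 2 + 10 * x) + (t - 1) ^ 5 * (1 / 2 + 2 * x)
      = (2 * (x - 1 / 2) ^ 2 + (t - 1) * (-3 / 2 + 8 * x) + 3 * (t - 1) ^ 3)
        + ((t - 1) * (2 * x ^ 2) + (t - 1) ^ 2 * (22 * x + x ^ 2) + (t - 1) ^ 3 * (22 * x)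
        + (t - 1) ^ 4 * (5 / 2 + 10 * x) + (t - 1) ^ 5 * (1 / 2 + 2 * x)) := by ring
  linarith [key.le, key.ge, hsplit.le, hsplit.ge]

/-- **THE PER-UNIT-SHARE COST IS AT MOST `5∕8` — ANY SHAPE, ANY AMPLITUDE.**  For `0 ≤ x`, `1 ≤ y`, `t > 0`, `t² = y`, and the window integral bounded by the bathtub
`I ≤ (1−x)·y − (1−x)²∕(2t)` (speed ratio `≤ t`, time budget `1 − x`, levels `≤ y`): `(1∕2)·x∕(y·t) + (1∕2)·((y+1)∕y²)·I ≤ 5∕8` — the inflow piece of (E129) `direct_c1_le`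
plus the window-shift piece of `window_shift_time_le`. [folklore] -/
theorem block_timebudget_le {x y t I : ℝ} (hx0 : 0 ≤ x) (hy1 : 1 ≤ y) (ht : 0 < t) (hty : t ^ 2 = y)
    (hI : I ≤ (1 - x) * y - (1 - x) ^ 2 / (2 * t)) :
    1 / 2 * (x / (y * t)) + 1 / 2 * ((y + 1) / y ^ 2 * I) ≤ 5 / 8 := by
  have hy0 : 0 < y := by linarith
  have ht1 : 1 ≤ t := by nlinarith
  have hfac : 0 ≤ 1 / 2 * ((y + 1) / y ^ 2) := by positivity
  have step : 1 / 2 * ((y + 1) / y ^ 2 * I) ≤ 1 / 2 * ((y + 1) / y ^ 2) * ((1 - x) * y - (1 - x) ^ 2 / (2 * t)) := by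
    have := mul_le_mul_of_nonneg_left hI hfac
    linarith [this]
  have hp := bathtub_poly_le hx0 ht1
  have e : 1 / 2 * (x / (y * t)) + 1 / 2 * ((y + 1) / y ^ 2) * ((1 - x) * y - (1 - x) ^ 2 / (2 * t))
      = (2 * x * t ^ 2 + (t ^ 2 + 1) * (1 - x) * (2 * t ^ 3 - (1 - x))) / (4 * t ^ 5) := by
    rw [← hty]; field_simp; ring
  have hden : 0 < 4 * t ^ 5 := by positivity
  have fin : (2 * x * t ^ 2 + (t ^ 2 + 1) * (1 - x) * (2 * t ^ 3 - (1 - x))) / (4 * t ^ 5) ≤ 5 / 8 := by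
    rw [div_le_iff₀ hden]; linarith
  linarith [e.le, e.ge]

/-! ## §3 The budget sum and the gauge step -/

variable {ι : Type*}

/-- **THE DIRECT COST IS AT MOST `5∕8` — EVERY ADMISSIBLE SHAPE, EVERY AMPLITUDE.**  Blocks `r ∈ S` at the pin with base shares `s_r ≥ 0`, `Σ s_r ≤ 1` (budget), each
with `0 ≤ x_r`, `1 ≤ y_r`, `t_r > 0`, `t_r² = y_r`, window integrals `I_r ≤ (1−x_r)y_r − (1−x_r)²∕(2t_r)` (bathtub), and per-block pieces `c1_r ≤ (s_r∕2)·x_r∕(y_rt_r)`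
((E129) `direct_c1_le`), `c2_r ≤ (s_r∕2)·((y_r+1)∕y_r²)·I_r` (`window_shift_time_le`).  Then `Σ_r (c1_r + c2_r) ≤ 5∕8`. [folklore] -/
theorem cost_timebudget_le (S : Finset ι) {s x y t I c1 c2 : ι → ℝ} (hs : ∀ r ∈ S, 0 ≤ s r) (hsum : ∑ r ∈ S, s r ≤ 1)
    (hx0 : ∀ r ∈ S, 0 ≤ x r) (hy1 : ∀ r ∈ S, 1 ≤ y r) (ht : ∀ r ∈ S, 0 < t r) (hty : ∀ r ∈ S, t r ^ 2 = y r)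
    (hI : ∀ r ∈ S, I r ≤ (1 - x r) * y r - (1 - x r) ^ 2 / (2 * t r))
    (hc1 : ∀ r ∈ S, c1 r ≤ s r / 2 * (x r / (y r * t r))) (hc2 : ∀ r ∈ S, c2 r ≤ s r / 2 * ((y r + 1) / y r ^ 2 * I r)) :
    ∑ r ∈ S, (c1 r + c2 r) ≤ 5 / 8 := by
  have hterm : ∀ r ∈ S, c1 r + c2 r ≤ s r * (5 / 8) := by
    intro r hr
    have hb := block_timebudget_le (hx0 r hr) (hy1 r hr) (ht r hr) (hty r hr) (hI r hr)
    have e : s r / 2 * (x r / (y r * t r)) + s r / 2 * ((y r + 1) / y r ^ 2 * I r)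
        = s r * (1 / 2 * (x r / (y r * t r)) + 1 / 2 * ((y r + 1) / y r ^ 2 * I r)) := by ring
    have := mul_le_mul_of_nonneg_left hb (hs r hr)
    linarith [hc1 r hr, hc2 r hr, e.le, e.ge]
  calc ∑ r ∈ S, (c1 r + c2 r) ≤ ∑ r ∈ S, s r * (5 / 8) := sum_le_sum hterm
    _ = (∑ r ∈ S, s r) * (5 / 8) := by rw [sum_mul]
    _ ≤ 1 * (5 / 8) := mul_le_mul_of_nonneg_right hsum (by norm_num)
    _ = 5 / 8 := one_mul _

/-- **THE GAUGE STEP — EVERY ADMISSIBLE SHAPE, EVERY AMPLITUDE.**  If `α·X′ ≤ X·C` (the derivative identity of g102 §4 (d), source term `ηe′ ≤ 0` dropped, pieces summed: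
`C = Σ_r (c1_r + c2_r)`), the blocks satisfy the hypotheses of `cost_timebudget_le`, and `X ≥ 0` at the pin, then `α·X′ − X ≤ −(3∕8)·X`: the level gauge `X∕α`
strictly decreases going up while `X > 0` — the inequality the continuous induction (README §2 Step 5) propagates from the support top to every pin. [folklore] -/
theorem gauge_timebudget_decreasing (S : Finset ι) {s x y t I c1 c2 : ι → ℝ} {α X Xp : ℝ} (hs : ∀ r ∈ S, 0 ≤ s r) (hsum : ∑ r ∈ S, s r ≤ 1)
    (hx0 : ∀ r ∈ S, 0 ≤ x r) (hy1 : ∀ r ∈ S, 1 ≤ y r) (ht : ∀ r ∈ S, 0 < t r) (hty : ∀ r ∈ S, t r ^ 2 = y r)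
    (hI : ∀ r ∈ S, I r ≤ (1 - x r) * y r - (1 - x r) ^ 2 / (2 * t r))
    (hc1 : ∀ r ∈ S, c1 r ≤ s r / 2 * (x r / (y r * t r))) (hc2 : ∀ r ∈ S, c2 r ≤ s r / 2 * ((y r + 1) / y r ^ 2 * I r))
    (hXp : α * Xp ≤ X * ∑ r ∈ S, (c1 r + c2 r)) (hX : 0 ≤ X) : α * Xp - X ≤ -(3 / 8) * X := by
  have hC := cost_timebudget_le S hs hsum hx0 hy1 ht hty hI hc1 hc2
  have := mul_le_mul_of_nonneg_left hC hX
  linarith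

/-! ## §4 (v1.1) The discrete bathtub -/

/-- **THE DISCRETE BATHTUB.**  `k` window levels `a_0, …, a_{k−1}` packed below a top `Y` with spacing at least `d ≥ 0` from the top down — `a_l ≤ Y − (k−1−l)·d` (on the
lattice: consecutive perturbed levels differ by at least the base speed there, README §4 (3″) (e)) — have `Σ_l a_l ≤ k·Y − d·k(k−1)∕2`: all the time spent as high as the
spacing allows.  [folklore] -/
theorem discrete_bathtub_le {a : ℕ → ℝ} {Y d : ℝ} (k : ℕ) (ha : ∀ l, l < k → a l ≤ Y - ((k : ℝ) - 1 - l) * d) :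
    ∑ l ∈ range k, a l ≤ (k : ℝ) * Y - d * ((k : ℝ) * ((k : ℝ) - 1) / 2) := by
  have hsum : ∑ l ∈ range k, a l ≤ ∑ l ∈ range k, (Y - ((k : ℝ) - 1 - l) * d) :=
    sum_le_sum fun l hl => ha l (mem_range.mp hl)
  have hgauss : ∀ n : ℕ, ∑ l ∈ range n, (Y - ((n : ℝ) - 1 - l) * d) = (n : ℝ) * Y - d * ((n : ℝ) * ((n : ℝ) - 1) / 2) := by
    intro n
    have key : ∀ n : ℕ, ∑ l ∈ range n, ((l : ℝ)) = (n : ℝ) * ((n : ℝ) - 1) / 2 := by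
      intro n
      induction n with
      | zero => simp
      | succ m ih => rw [sum_range_succ, ih]; push_cast; ring
    have e1 : ∑ l ∈ range n, (Y - ((n : ℝ) - 1 - l) * d) = ∑ l ∈ range n, ((Y - ((n : ℝ) - 1) * d) + d * (l : ℝ)) :=
      sum_congr rfl fun l _ => by ring
    rw [e1, sum_add_distrib, sum_const, card_range, ← mul_sum, key n]
    simp only [nsmul_eq_mul]
    ring
  rw [hgauss k] at hsum
  exact hsum

/-- **SATURATING THE BUDGET.**  The bathtub value `y·m − m²∕(2t)` is non-decreasing in the mass `m` as long as `m ≤ t·y`; so a window using only part `m ≤ T` of the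
time budget `T ≤ t·y` obeys `y·m − m²∕(2t) ≤ y·T − T²∕(2t)` (`t > 0`) — the form fed to `block_timebudget_le` with `T = 1 − x ≤ 1 ≤ t·y`. [folklore] -/
theorem bathtub_mass_mono {y t m T : ℝ} (ht : 0 < t) (hm : m ≤ T) (hT : T ≤ t * y) :
    y * m - m ^ 2 / (2 * t) ≤ y * T - T ^ 2 / (2 * t) := by
  -- difference = (T − m)·(y − (T + m)∕(2t)) ≥ 0
  have e : (y * T - T ^ 2 / (2 * t)) - (y * m - m ^ 2 / (2 * t)) = (T - m) * (y - (T + m) / (2 * t)) := by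
    field_simp
    ring
  have h1 : 0 ≤ T - m := by linarith
  have h2 : 0 ≤ y - (T + m) / (2 * t) := by
    rw [sub_nonneg, div_le_iff₀ (by positivity)]
    nlinarith
  nlinarith [mul_nonneg h1 h2, e]

end Summit.QuantumFields.BalabanUV.Beta.EriceRemainderEnclosureHistoryAutonomyComparisonContinuumTimeBudget

end
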